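import Literature.NumberTheory.EllipticCurves.PadicSigmaLogFirstOrderProofs
import HarnessLib

/-!
# The canonical `p`-adic height to FIRST order and the cancellation
# `ĥ_p(P) = log_p(num x(P)) + O(‖z(P)‖²)` on every model (genuine Mazur–Tate sigma function, odd `p`)

Sibling proof file of `CanonicalPAdicHeight.lean` / `CanonicalPAdicHeightNumeratorProofs.lean` /
`PadicSigmaLogFirstOrderProofs.lean` (pure proofs: no definitions, no named facts). The tree's canonical
cyclotomic `p`-adic height is the sigma formula `ĥ_p(P) = log_p(den x(P)) - 2 log_p σ_p(z(P))`,
`z(P) = -x/y` (Stein–Wuthrich 2013 (4.1) = `-2p ×` Mazur–Stein–Tate 2006 (1.1)). The numerator file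
proved `‖ĥ_p(P) - log_p(num x)‖ ≤ ‖z(P)‖` on any `ℤ`-integral model (and `≤ ‖x‖⁻¹` only for
`a₁ = a₃ = 0`). From the sigma–log lemma `log_p σ_p(t) = log_p t + (a₁/2)t + O(t²)` for a GENUINE
Mazur–Tate pair (`PadicSigmaLogFirstOrderProofs`) this file derives the first-order height formula of
every digit-level computation (MST 2006 §1, Thm. 1.3 / Rem. 1.4; Harvey 2008 §5, Lemma 8;
Balakrishnan 2016 §2 at `p = 3`):

* `norm_canonicalPAdicHeight_sub_firstOrder_le` — `p` odd, pair for `W ⊗ ℚ_p`, `0 < ‖x/y‖ < 1`: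
  **`‖ĥ_p(P) - (log_p(den x) - 2 log_p(-x/y) + a₁·(x/y))‖ ≤ ‖x/y‖²`** (no integrality needed for the
  VALUE); `…_of_one_lt_norm`: `≤ ‖x‖⁻¹` on `E₁(ℚ_p)` for an integral model;
* `norm_canonicalPAdicHeight_sub_padicLog_num_le_sq` — **THE CANCELLATION** (`ℤ`-integral model, `p`
  odd, pair, `‖x‖_p > 1`): `‖ĥ_p(P) - log_p(num x)‖ ≤ ‖x/y‖² = ‖x‖⁻¹`. With `1 - a₁t - a₃t/x = x(1+u)t²`
  (curve equation) and `σ_p(t) = t(1+z)`, `z = (a₁/2)t + O(t²)`, the first-order terms `+a₁t`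
  (denominator side) and `-2·(a₁/2)t` (sigma side) CANCEL, so the numerator formula holds to second
  order on EVERY model (the tree's `…_num_le_inv` is `a₁ = a₃ = 0`, where both vanish separately);
* for THE canonical datum (`PAdicHeightData.IsCanonical`) and admissible points:
  `IsCanonical.norm_pairing_self_sub_padicLog_num_le_sq`; and with the pair hypothesis discharged —
  `…_of_isAdmissible_of_five_le` (unconditional: tree theorem `mazur_tate_sigma_exists_odd_of_five_le`,
  Blakestad–Grant 2023) and `…_of_isAdmissible_of_odd` (CONDITIONAL on the named fact
  `mazur_tate_sigma_exists_odd`, Mazur–Tate 1991 Thm. 3.1 / Balakrishnan 2016 (2.3), whose only new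
  content is `p = 3`, `mazur_tate_sigma_exists_odd_iff_three`).

The first `3`-adic DIGIT of `ĥ₃(P)` (`ĥ₃(P) ≡ ((num x)² - 1)/2 mod 9`) is derived from the cancellation
in `CanonicalPAdicHeightThreeAdicDigitProofs.lean`.

With the junk value `σ_p = t` (no pair) one would get `ĥ_p(P) = log_p(num x) + a₁t + O(t²)` instead —
the pair hypothesis cannot be dropped.

## References

* [MazurSteinTate2006] Doc. Math. Extra Vol. Coates (2006), §1 eq. (1.1), Thm. 1.3, Rem. 1.4.
* [Harvey2008] LMS J. Comput. Math. 11 (2008), §5 (`log_p(σ_p(P)/d(P)) = log_p((-α/β)(1 + Σ c_{k+1}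
  t^k))`), Lemma 8. [Balakrishnan2016] J. Number Theory 161 (2016), §2 eq. (2.3) (`p = 3`).
* [SteinWuthrich2013] Math. Comp. 82 (2013), §4.1 (4.1). [SilvermanAEC2009] AEC VII.2.2.

## Design

Hypotheses are what the VALUE `canonicalPAdicHeight p P` needs (`[W.IsIntegral ℤ]`, `p ≠ 2`,
`‖x‖_p > 1`) plus the plain hypothesis `∃ σ c, (W.baseChange ℚ_[p]).IsMazurTateSigmaPair σ c` (core
theorems unconditional). Errors as `‖x/y‖²`, `‖x‖⁻¹`; `x.num` is Mathlib's lowest-terms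
numerator (`= ±φₙ` for `x = φₙ/ψₙ²` with `gcd(φₙ, ψₙ) = 1`, `isCoprime_evalEval_φ_ψ`). Declarations sit
in `namespace WeierstrassCurve` as dot-notation companions of `canonicalPAdicHeight` (sibling files).
-/

noncomputable section

open scoped Classical
open PowerSeries Literature.NumberTheory.EllipticCurves

namespace WeierstrassCurve

/-! ### The height to first order -/

section Height

variable {p : ℕ} [Fact p.Prime] (W : WeierstrassCurve ℚ)

/-- **`ĥ_p(P) = log_p(den x) - 2 log_p(z(P)) - a₁ z(P) + O(z(P)²)`** (from the sigma formula
`ĥ_p(P) = log_p(den x) - 2 log_p σ_p(z(P))` and the sigma–log lemma): for `p` odd, `W ⊗ ℚ_p` with a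
Mazur–Tate pair and `P = (x, y)` with `x, y ≠ 0` in `ℚ_p` and `‖x/y‖_p < 1` (`z(P) = -x/y`, so
`-a₁ z(P) = +a₁·x/y`): `‖ĥ_p(P) - (log_p(den x) - 2 log_p(-x/y) + a₁·(x/y))‖ ≤ ‖x/y‖²`. No
integrality, minimality or reduction hypothesis is needed for the VALUE of the formula.
[Mazur–Stein–Tate 2006, §1 eq. (1.1), Thm. 1.3; Stein–Wuthrich 2013, §4.1 eq. (4.1); Harvey 2008, §5]
[cite: Harvey2008, §5 and Lemma 8] -/
theorem norm_canonicalPAdicHeight_sub_firstOrder_le (hp : p ≠ 2)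
    (hσ : ∃ σ : ℚ_[p]⟦X⟧, ∃ c : ℚ_[p], (W.baseChange ℚ_[p]).IsMazurTateSigmaPair σ c)
    {x y : ℚ} (h : W.toAffine.Nonsingular x y) (hx0 : (x : ℚ_[p]) ≠ 0) (hy0 : (y : ℚ_[p]) ≠ 0)
    (ht : ‖(x : ℚ_[p]) / y‖ < 1) :
    ‖W.canonicalPAdicHeight p (.some x y h) -
        (padicLog p ((x.den : ℚ) : ℚ_[p]) - 2 * padicLog p (-(x : ℚ_[p]) / y)
          + (W.a₁ : ℚ_[p]) * ((x : ℚ_[p]) / y))‖ ≤ ‖(x : ℚ_[p]) / y‖ ^ 2 := by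
  set t : ℚ_[p] := -(x : ℚ_[p]) / y with htdef
  have ht0 : t ≠ 0 := div_ne_zero (neg_ne_zero.mpr hx0) hy0
  have hnt : ‖t‖ = ‖(x : ℚ_[p]) / y‖ := by rw [htdef, neg_div, norm_neg]
  have ht1 : ‖t‖ < 1 := hnt ▸ ht
  have key := W.norm_padicLog_padicSigmaEval_sub_le hp hσ ht0 ht1
  have hxy : ((x : ℚ_[p]) / y) = -t := by rw [htdef, neg_div, neg_neg]
  have hrew : W.canonicalPAdicHeight p (.some x y h) -
      (padicLog p ((x.den : ℚ) : ℚ_[p]) - 2 * padicLog p t + (W.a₁ : ℚ_[p]) * ((x : ℚ_[p]) / y)) =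
      -2 * (padicLog p (W.padicSigmaEval p t) - padicLog p t - (W.a₁ : ℚ_[p]) / 2 * t) := by
    rw [canonicalPAdicHeight_some, padicSigmaAt, padicParam_some, ← htdef, hxy]
    ring
  have h2le : ‖(2 : ℚ_[p])‖ ≤ 1 := by simpa using norm_natCast_le_one (p := p) 2
  rw [hrew, norm_mul, norm_neg, ← hnt]
  calc ‖(2 : ℚ_[p])‖ * ‖padicLog p (W.padicSigmaEval p t) - padicLog p t - (W.a₁ : ℚ_[p]) / 2 * t‖
      ≤ 1 * ‖t‖ ^ 2 := mul_le_mul h2le key (norm_nonneg _) zero_le_one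
    _ = ‖t‖ ^ 2 := one_mul _

variable [W.IsIntegral ℤ]

variable {W} in
/-- On `E₁(ℚ_p)` the parameter is small: for a `ℤ`-integral equation and `P = (x, y) ∈ E(ℚ)` with
`‖x‖_p > 1`: `x, y ≠ 0` in `ℚ_p`, `‖x/y‖_p < 1` and `‖x/y‖_p² = ‖x‖_p⁻¹` (`3v(x) = 2v(y)`; tree
`norm_div_sq_eq_inv_norm_of_one_lt_norm`). [Silverman AEC VII.2.2] [cite: SilvermanAEC2009, VII.2.2] -/
theorem cast_ne_zero_of_one_lt_norm {x y : ℚ} (h : W.toAffine.Nonsingular x y)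
    (hx : 1 < ‖(x : ℚ_[p])‖) :
    (x : ℚ_[p]) ≠ 0 ∧ (y : ℚ_[p]) ≠ 0 ∧ ‖(x : ℚ_[p]) / y‖ < 1 ∧
      ‖(x : ℚ_[p]) / y‖ ^ 2 = ‖(x : ℚ_[p])‖⁻¹ := by
  have hsq := norm_div_sq_eq_inv_norm_of_one_lt_norm (p := p) h hx
  have hXpos : 0 < ‖(x : ℚ_[p])‖ := one_pos.trans hx
  have hx0 : (x : ℚ_[p]) ≠ 0 := norm_pos_iff.mp hXpos
  have hinv1 : ‖(x : ℚ_[p])‖⁻¹ < 1 := inv_lt_one_of_one_lt₀ hx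
  have hy0 : (y : ℚ_[p]) ≠ 0 := by
    intro hy
    rw [hy, div_zero, norm_zero, zero_pow two_ne_zero] at hsq
    exact (inv_pos.mpr hXpos).ne' hsq.symm
  refine ⟨hx0, hy0, ?_, hsq⟩
  have h2 : ‖(x : ℚ_[p]) / y‖ ^ 2 < 1 := hsq ▸ hinv1
  exact (pow_lt_one_iff_of_nonneg (norm_nonneg _) two_ne_zero).mp h2

/-- The first-order formula on `E₁(ℚ_p)` (`ℤ`-integral equation, `p` odd, `‖x‖_p > 1`, Mazur–Tate
pair for `W ⊗ ℚ_p`): `‖ĥ_p(P) - (log_p(den x) - 2 log_p(-x/y) + a₁·(x/y))‖ ≤ ‖x‖_p⁻¹` (`= ‖x/y‖²`).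
[Mazur–Stein–Tate 2006, §1 eq. (1.1), Thm. 1.3; Harvey 2008, §5] [cite: Harvey2008, §5 and Lemma 8] -/
theorem norm_canonicalPAdicHeight_sub_firstOrder_le_of_one_lt_norm (hp : p ≠ 2)
    (hσ : ∃ σ : ℚ_[p]⟦X⟧, ∃ c : ℚ_[p], (W.baseChange ℚ_[p]).IsMazurTateSigmaPair σ c)
    {x y : ℚ} (h : W.toAffine.Nonsingular x y) (hx : 1 < ‖(x : ℚ_[p])‖) :
    ‖W.canonicalPAdicHeight p (.some x y h) -
        (padicLog p ((x.den : ℚ) : ℚ_[p]) - 2 * padicLog p (-(x : ℚ_[p]) / y)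
          + (W.a₁ : ℚ_[p]) * ((x : ℚ_[p]) / y))‖ ≤ ‖(x : ℚ_[p])‖⁻¹ := by
  obtain ⟨hx0, hy0, ht, hsq⟩ := cast_ne_zero_of_one_lt_norm (p := p) h hx
  rw [← hsq]
  exact W.norm_canonicalPAdicHeight_sub_firstOrder_le hp hσ h hx0 hy0 ht

/-- **The canonical `p`-adic height is `log_p` of the numerator of `x` to SECOND order** (the
cancellation): for a `ℤ`-integral Weierstrass equation `W/ℚ`, an odd prime `p` such that `W ⊗ ℚ_p`
has a Mazur–Tate pair, and `P = (x, y) ∈ E(ℚ)` with `‖x‖_p > 1`, writing `x = α/d²` in lowest terms,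
`‖ĥ_p(P) - log_p α‖_p ≤ ‖x/y‖_p² = ‖x‖_p⁻¹`. Proof: with `t = z(P) = -x/y`,
`u = a₂/x + a₄/x² + a₆/x³` (`‖u‖ ≤ ‖x‖⁻¹ = ‖t‖²`) the equation reads `1 + w = x(1+u)t²`,
`w = -a₁t - a₃t/x`; with `σ_p(t) = t(1+z)`, `‖z - (a₁/2)t‖ ≤ ‖t‖²`, and `log_p` multiplicative,
`ĥ_p(P) - log_p α = log_p(1+u) - log_p(1+w) - 2 log_p(1+z)`; expanding each logarithm to first order
the terms `-w = a₁t + a₃t/x` and `-2z = -a₁t + O(t²)` cancel to `O(t²)`. The tree's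
`norm_canonicalPAdicHeight_sub_padicLog_num_le_inv` is the case `a₁ = a₃ = 0` (no pair hypothesis).
[Harvey 2008, §5 and Lemma 8; Mazur–Stein–Tate 2006, §1 eq. (1.1), Thm. 1.3 and Rem. 1.4]
[cite: Harvey2008, §5 and Lemma 8] -/
theorem norm_canonicalPAdicHeight_sub_padicLog_num_le_sq (hp : p ≠ 2)
    (hσ : ∃ σ : ℚ_[p]⟦X⟧, ∃ c : ℚ_[p], (W.baseChange ℚ_[p]).IsMazurTateSigmaPair σ c)
    {x y : ℚ} (h : W.toAffine.Nonsingular x y) (hx : 1 < ‖(x : ℚ_[p])‖) :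
    ‖W.canonicalPAdicHeight p (.some x y h) - padicLog p (x.num : ℚ_[p])‖ ≤
      ‖(x : ℚ_[p]) / y‖ ^ 2 := by
  obtain ⟨hX0, hY, ht1', htx'⟩ := cast_ne_zero_of_one_lt_norm (p := p) h hx
  set X : ℚ_[p] := (x : ℚ_[p]) with hXdef
  set Y : ℚ_[p] := (y : ℚ_[p]) with hYdef
  set t : ℚ_[p] := -X / Y with htdef
  set L := padicLog p with hLdef
  have hnt : ‖t‖ = ‖X / Y‖ := by rw [htdef, neg_div, norm_neg]
  have ht1 : ‖t‖ < 1 := hnt ▸ ht1'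
  have htx : ‖t‖ ^ 2 = ‖X‖⁻¹ := by rw [hnt]; exact htx'
  have hx0 : x ≠ 0 := by rintro rfl; exact hX0 (by rw [hXdef, Rat.cast_zero])
  have ht0 : t ≠ 0 := div_ne_zero (neg_ne_zero.mpr hX0) hY
  have htpos : 0 < ‖t‖ := norm_pos_iff.mpr ht0
  have hX1 : 1 ≤ ‖X‖ := hx.le
  have hXpos : 0 < ‖X‖ := one_pos.trans_le hX1
  have ht2le : ‖t‖ ^ 2 ≤ ‖t‖ := by rw [sq]; exact mul_le_of_le_one_left (norm_nonneg _) ht1.le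
  -- integrality of the coefficients
  have ha₁ : ‖(W.a₁ : ℚ_[p])‖ ≤ 1 := (mem_localIntegers_iff p _).mp (W.a₁_mem_localIntegers p)
  have ha₂ : ‖(W.a₂ : ℚ_[p])‖ ≤ 1 := (mem_localIntegers_iff p _).mp (W.a₂_mem_localIntegers p)
  have ha₃ : ‖(W.a₃ : ℚ_[p])‖ ≤ 1 := (mem_localIntegers_iff p _).mp (W.a₃_mem_localIntegers p)
  have ha₄ : ‖(W.a₄ : ℚ_[p])‖ ≤ 1 := (mem_localIntegers_iff p _).mp (W.a₄_mem_localIntegers p)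
  have ha₆ : ‖(W.a₆ : ℚ_[p])‖ ≤ 1 := (mem_localIntegers_iff p _).mp (W.a₆_mem_localIntegers p)
  -- the curve equation in `ℚ_p`
  have heq : Y ^ 2 + (W.a₁ : ℚ_[p]) * X * Y + (W.a₃ : ℚ_[p]) * Y =
      X ^ 3 + (W.a₂ : ℚ_[p]) * X ^ 2 + (W.a₄ : ℚ_[p]) * X + (W.a₆ : ℚ_[p]) := by
    have e := (WeierstrassCurve.Affine.equation_iff x y).mp h.1
    have e' := congrArg (fun q : ℚ => (q : ℚ_[p])) e
    push_cast at e'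
    exact e'
  -- `u` and its norm
  set u : ℚ_[p] := (W.a₂ : ℚ_[p]) / X + (W.a₄ : ℚ_[p]) / X ^ 2 + (W.a₆ : ℚ_[p]) / X ^ 3 with hudef
  have hterm : ∀ (a : ℚ_[p]) (k : ℕ), ‖a‖ ≤ 1 → 1 ≤ k → ‖a / X ^ k‖ ≤ ‖X‖⁻¹ := by
    intro a k ha hk
    rw [norm_div, norm_pow]
    calc ‖a‖ / ‖X‖ ^ k ≤ 1 / ‖X‖ ^ k := by gcongr
      _ ≤ 1 / ‖X‖ ^ 1 :=
          div_le_div_of_nonneg_left zero_le_one (pow_pos hXpos 1) (pow_le_pow_right₀ hX1 hk)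
      _ = ‖X‖⁻¹ := by rw [pow_one, one_div]
  have hu : ‖u‖ ≤ ‖t‖ ^ 2 := by
    rw [htx]
    refine (IsUltrametricDist.norm_add_le_max _ _).trans (max_le ?_ (hterm _ 3 ha₆ (by omega)))
    refine (IsUltrametricDist.norm_add_le_max _ _).trans (max_le ?_ (hterm _ 2 ha₄ (by omega)))
    simpa using hterm _ 1 ha₂ le_rfl
  have hu1 : ‖u‖ < 1 := hu.trans_lt (pow_lt_one₀ (norm_nonneg _) ht1 two_ne_zero)
  have h1u : ‖1 - (1 + u)‖ < 1 := by rwa [sub_add_cancel_left, norm_neg]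
  have h1u0 : 1 + u ≠ 0 := by
    intro h0; rw [h0, sub_zero, norm_one] at h1u; exact lt_irrefl _ h1u
  -- `w = -a₁t - a₃t/X`, `1 + w = X (1+u) t²`
  set w : ℚ_[p] := -((W.a₁ : ℚ_[p]) * t) - (W.a₃ : ℚ_[p]) * t / X with hwdef
  have hB : 1 + w = X * (1 + u) * t ^ 2 := by
    rw [hwdef, hudef, htdef]
    field_simp
    linear_combination heq
  have ha₃t : ‖(W.a₃ : ℚ_[p]) * t / X‖ ≤ ‖t‖ ^ 2 := by
    rw [norm_div, norm_mul, div_le_iff₀ hXpos, htx]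
    calc ‖(W.a₃ : ℚ_[p])‖ * ‖t‖ ≤ 1 * 1 := mul_le_mul ha₃ ht1.le (norm_nonneg _) zero_le_one
      _ = ‖X‖⁻¹ * ‖X‖ := by rw [one_mul, inv_mul_cancel₀ hXpos.ne']
  have hw : ‖w‖ ≤ ‖t‖ := by
    have : w = -((W.a₁ : ℚ_[p]) * t) + -((W.a₃ : ℚ_[p]) * t / X) := by rw [hwdef, sub_eq_add_neg]
    rw [this]
    refine (IsUltrametricDist.norm_add_le_max _ _).trans (max_le ?_ ?_)
    · rw [norm_neg, norm_mul]; exact mul_le_of_le_one_left (norm_nonneg _) ha₁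
    · rw [norm_neg]; exact ha₃t.trans ht2le
  have hw1 : ‖w‖ < 1 := hw.trans_lt ht1
  have h1w0 : 1 + w ≠ 0 := by
    rw [hB]; exact mul_ne_zero (mul_ne_zero hX0 h1u0) (pow_ne_zero 2 ht0)
  -- `σ_p(t) = t (1 + z)`
  set σ : ℚ_[p] := W.padicSigmaEval p t with hσdef
  set z : ℚ_[p] := σ / t - 1 with hzdef
  have hσz : σ = t * (1 + z) := by rw [hzdef, add_sub_cancel, mul_div_cancel₀ _ ht0]
  have hz_eq : z = (σ - t) / t := by rw [hzdef, sub_div, div_self ht0]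
  have hz_le : ‖z‖ ≤ ‖t‖ := by
    rw [hz_eq, norm_div, div_le_iff₀ htpos, ← sq]
    exact W.norm_padicSigmaEval_sub_self_le_sq ht1
  have hz1 : ‖z‖ < 1 := hz_le.trans_lt ht1
  have h1z0 : 1 + z ≠ 0 := by
    intro h0
    have : ‖1 - (1 + z)‖ < 1 := by rwa [sub_add_cancel_left, norm_neg]
    rw [h0, sub_zero, norm_one] at this
    exact lt_irrefl _ this
  have hz2 : ‖z - (W.a₁ : ℚ_[p]) / 2 * t‖ ≤ ‖t‖ ^ 2 := by
    have : z - (W.a₁ : ℚ_[p]) / 2 * t = (σ - t - (W.a₁ : ℚ_[p]) / 2 * t ^ 2) / t := by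
      rw [hz_eq]; field_simp
    rw [this, norm_div, div_le_iff₀ htpos, show ‖t‖ ^ 2 * ‖t‖ = ‖t‖ ^ 3 by ring]
    exact W.norm_padicSigmaEval_sub_sub_le hσ ht1
  -- numerator and denominator
  have hnum0 : (x.num : ℚ_[p]) ≠ 0 := by exact_mod_cast Rat.num_ne_zero.mpr hx0
  have hXnd : X = (x.num : ℚ_[p]) / (x.den : ℚ_[p]) := by
    rw [hXdef]; exact_mod_cast (Rat.num_div_den x).symm
  have hden : ((x.den : ℚ) : ℚ_[p]) = (x.num : ℚ_[p]) * X⁻¹ := by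
    rw [hXnd, inv_div, mul_div_cancel₀ _ hnum0]; norm_cast
  -- logarithms
  have hLinv : L X⁻¹ = -L X := by
    have e := padicLog_mul_holds p hX0 (inv_ne_zero hX0)
    rw [mul_inv_cancel₀ hX0, padicLog_one] at e
    rw [hLdef]; linear_combination -e
  have hLden : L ((x.den : ℚ) : ℚ_[p]) = L (x.num : ℚ_[p]) - L X := by
    rw [hden, hLdef, padicLog_mul_holds p hnum0 (inv_ne_zero hX0), ← hLdef, hLinv]; ring
  have hLσ : L σ = L t + L (1 + z) := by rw [hσz, hLdef, padicLog_mul_holds p ht0 h1z0]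
  have hLB : L (1 + w) = L X + L (1 + u) + 2 * L t := by
    rw [hB, hLdef, padicLog_mul_holds p (mul_ne_zero hX0 h1u0) (pow_ne_zero 2 ht0),
      padicLog_mul_holds p hX0 h1u0, padicLog_sq ht0]
  have hmain : W.canonicalPAdicHeight p (.some x y h) - L (x.num : ℚ_[p]) =
      L (1 + u) + -(L (1 + w) - w) + -(2 * (L (1 + z) - z))
        + -(2 * (z - (W.a₁ : ℚ_[p]) / 2 * t)) + (W.a₃ : ℚ_[p]) * t / X := by
    rw [canonicalPAdicHeight_some, padicSigmaAt, padicParam_some, ← hLdef, ← hσdef, hLden, hLσ]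
    linear_combination hLB - hwdef
  -- norms of the five terms
  have n1 : ‖L (1 + u)‖ ≤ ‖t‖ ^ 2 := by
    rw [hLdef, norm_padicLog_eq_norm_one_sub hp h1u, sub_add_cancel_left, norm_neg]; exact hu
  have n2 : ‖-(L (1 + w) - w)‖ ≤ ‖t‖ ^ 2 := by
    rw [norm_neg, hLdef]
    exact (norm_padicLog_one_add_sub_le hp hw1).trans (pow_le_pow_left₀ (norm_nonneg _) hw 2)
  have h2le : ‖(2 : ℚ_[p])‖ ≤ 1 := by simpa using norm_natCast_le_one (p := p) 2
  have n3 : ‖-(2 * (L (1 + z) - z))‖ ≤ ‖t‖ ^ 2 := by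
    rw [norm_neg, norm_mul]
    calc ‖(2 : ℚ_[p])‖ * ‖L (1 + z) - z‖ ≤ 1 * ‖t‖ ^ 2 :=
          mul_le_mul h2le ((norm_padicLog_one_add_sub_le hp hz1).trans
            (pow_le_pow_left₀ (norm_nonneg _) hz_le 2)) (norm_nonneg _) zero_le_one
      _ = ‖t‖ ^ 2 := one_mul _
  have n4 : ‖-(2 * (z - (W.a₁ : ℚ_[p]) / 2 * t))‖ ≤ ‖t‖ ^ 2 := by
    rw [norm_neg, norm_mul]
    calc ‖(2 : ℚ_[p])‖ * ‖z - (W.a₁ : ℚ_[p]) / 2 * t‖ ≤ 1 * ‖t‖ ^ 2 :=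
          mul_le_mul h2le hz2 (norm_nonneg _) zero_le_one
      _ = ‖t‖ ^ 2 := one_mul _
  rw [hmain, ← hnt]
  refine (IsUltrametricDist.norm_add_le_max _ _).trans (max_le ?_ ha₃t)
  refine (IsUltrametricDist.norm_add_le_max _ _).trans (max_le ?_ n4)
  refine (IsUltrametricDist.norm_add_le_max _ _).trans (max_le ?_ n3)
  exact (IsUltrametricDist.norm_add_le_max _ _).trans (max_le n1 n2)

/-- The same with the error as `‖x‖_p⁻¹`: `‖ĥ_p(P) - log_p(num x)‖_p ≤ ‖x‖_p⁻¹`.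
[Harvey 2008, §5 and Lemma 8; Mazur–Stein–Tate 2006, Thm. 1.3] [cite: Harvey2008, §5 and Lemma 8] -/
theorem norm_canonicalPAdicHeight_sub_padicLog_num_le_inv_of_exists_pair (hp : p ≠ 2)
    (hσ : ∃ σ : ℚ_[p]⟦X⟧, ∃ c : ℚ_[p], (W.baseChange ℚ_[p]).IsMazurTateSigmaPair σ c)
    {x y : ℚ} (h : W.toAffine.Nonsingular x y) (hx : 1 < ‖(x : ℚ_[p])‖) :
    ‖W.canonicalPAdicHeight p (.some x y h) - padicLog p (x.num : ℚ_[p])‖ ≤ ‖(x : ℚ_[p])‖⁻¹ := by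
  rw [← (cast_ne_zero_of_one_lt_norm (p := p) h hx).2.2.2]
  exact W.norm_canonicalPAdicHeight_sub_padicLog_num_le_sq hp hσ h hx

end Height

/-! ### For THE canonical datum, and under the sigma-existence fact -/

section Canonical

variable {p : ℕ} [Fact p.Prime] {W : WeierstrassCurve ℚ}

/-- **For THE canonical datum**: if `D.IsCanonical`, `W` is `ℤ`-integral, `p` odd and `W ⊗ ℚ_p` has a
Mazur–Tate pair, then for every admissible `P = (x, y)`: `‖⟨P, P⟩_D - log_p(num x)‖_p ≤ ‖x/y‖_p²`.
[Mazur–Stein–Tate 2006, §1 eq. (1.1); Harvey 2008, §5] [cite: Harvey2008, §5 and Lemma 8] -/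
theorem PAdicHeightData.IsCanonical.norm_pairing_self_sub_padicLog_num_le_sq [W.IsIntegral ℤ]
    {D : PAdicHeightData W p} (hD : D.IsCanonical) (hp : p ≠ 2)
    (hσ : ∃ σ : ℚ_[p]⟦X⟧, ∃ c : ℚ_[p], (W.baseChange ℚ_[p]).IsMazurTateSigmaPair σ c)
    {x y : ℚ} {h : W.toAffine.Nonsingular x y} (hadm : W.IsAdmissible p (.some x y h)) :
    ‖D.pairing (.some x y h) (.some x y h) - padicLog p (x.num : ℚ_[p])‖ ≤ ‖(x : ℚ_[p]) / y‖ ^ 2 := by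
  rw [hD _ hadm]
  exact W.norm_canonicalPAdicHeight_sub_padicLog_num_le_sq hp hσ h hadm.2.1

variable (W) [W.IsElliptic] [W.IsGloballyMinimal]

/-- **The height of an admissible point to first order, `p ≥ 5` good ordinary** (unconditional, pair
from `mazur_tate_sigma_exists_odd_of_five_le`): `‖ĥ_p(P) - (log_p(den x) - 2 log_p(-x/y) + a₁·(x/y))‖
≤ 2‖x/y‖²` for every admissible `P = (x, y)` (the factor `2` is slack).
[Mazur–Stein–Tate 2006, §1 eq. (1.1), Thm. 1.3; Harvey 2008, §5] [cite: Harvey2008, §5 and Lemma 8] -/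
theorem norm_canonicalPAdicHeight_sub_firstOrder_le_of_isAdmissible_of_five_le (hp5 : 5 ≤ p)
    (hgood : W.HasGoodReductionAtPrime p) (hord : ¬ (p : ℤ) ∣ W.frobeniusTrace p)
    (x y : ℚ) (h : W.toAffine.Nonsingular x y) (hadm : W.IsAdmissible p (.some x y h)) :
    ‖W.canonicalPAdicHeight p (.some x y h) -
        (padicLog p ((x.den : ℚ) : ℚ_[p]) - 2 * padicLog p (-(x : ℚ_[p]) / y)
          + (W.a₁ : ℚ_[p]) * ((x : ℚ_[p]) / y))‖ ≤ 2 * ‖(x : ℚ_[p]) / y‖ ^ 2 := by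
  obtain ⟨hx0, hy0, ht, -⟩ := cast_ne_zero_of_one_lt_norm (p := p) h hadm.2.1
  exact (W.norm_canonicalPAdicHeight_sub_firstOrder_le (by omega)
    (mazur_tate_sigma_exists_odd_of_five_le W p hp5 hgood hord) h hx0 hy0 ht).trans
    (le_mul_of_one_le_left (by positivity) one_le_two)

/-- **The height of an admissible point to first order at an odd good ordinary prime, `p = 3`
included**, under `mazur_tate_sigma_exists_odd`: `‖ĥ_p(P) - (log_p(den x) - 2 log_p(-x/y) + a₁·(x/y))‖
≤ 2‖x/y‖²` for every admissible `P = (x, y)`. CONDITIONAL on that fact.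
[Balakrishnan 2016, §2 eq. (2.3); Mazur–Stein–Tate 2006, §1 eq. (1.1)] [cite: Balakrishnan2016, §2 eq. (2.3)] -/
theorem norm_canonicalPAdicHeight_sub_firstOrder_le_of_isAdmissible_of_odd
    (hex : mazur_tate_sigma_exists_odd) (hp : p ≠ 2)
    (hgood : W.HasGoodReductionAtPrime p) (hord : ¬ (p : ℤ) ∣ W.frobeniusTrace p)
    (x y : ℚ) (h : W.toAffine.Nonsingular x y) (hadm : W.IsAdmissible p (.some x y h)) :
    ‖W.canonicalPAdicHeight p (.some x y h) -
        (padicLog p ((x.den : ℚ) : ℚ_[p]) - 2 * padicLog p (-(x : ℚ_[p]) / y)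
          + (W.a₁ : ℚ_[p]) * ((x : ℚ_[p]) / y))‖ ≤ 2 * ‖(x : ℚ_[p]) / y‖ ^ 2 := by
  obtain ⟨hx0, hy0, ht, -⟩ := cast_ne_zero_of_one_lt_norm (p := p) h hadm.2.1
  exact (W.norm_canonicalPAdicHeight_sub_firstOrder_le hp (hex W p hp hgood hord) h hx0 hy0 ht).trans
    (le_mul_of_one_le_left (by positivity) one_le_two)

end Canonical

end WeierstrassCurve

end
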